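import Mathlib
import Literature.Geometry.DiscreteGeometry.CrystallographicGroups
import Summits.AtomisticToContinuum.Crystallization.Theorems.IsometryAtomsMinimisingLawsCohesiveGroupStructureAux1
import Summits.AtomisticToContinuum.Crystallization.Theorems.IsometryAtomsMinimisingLawsCohesiveGroupStructureAux3
import Summits.AtomisticToContinuum.Crystallization.Theorems.IsometryAtomsMinimisingLawsCohesiveGroupStructureAux4

/-!
# Discontinuous groups of isometries of `ℝ³`, part 5: all linear parts preserve the axis

Helper file for stub `stub_groupStructure` (F) of line `purity_stacking` of the crux
`IsometryAtoms.MinimisingLawsCohesive` (stmt-AtomisticToContinuum-15777).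

**Bieberbach's lemma, rank-zero case.** Let `Γ ≤ Isom(ℝ³)` be discontinuous WITHOUT nontrivial
translations, and let `g ∈ Γ` have linear part `A ≠ 1` of determinant one with `‖A - 1‖ ≤ 1/10`
and axis `u` (`A u = u`, `‖u‖ = 1`). Then EVERY `h ∈ Γ` has `L(h) u = ±u`. Proof: run the
commutator sequence `k₀ = h`, `k_{j+1} = [g, k_j]`; it reaches `1` (part 4); an element commuting
with `g` maps `u` into the fixed line of `A`; and if `L(k_{j+1}) u = ±u` then `w = L(k_j)⁻¹ u` is
fixed by `A²`, whose fixed line is again `ℝ u` (a small involution would be trivial), so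
`L(k_j) u = ±u` — downward induction.
-/

noncomputable section

open scoped RealInnerProductSpace
open Literature.Geometry.DiscreteGeometry.Crystallographic Module

namespace Summit.AtomisticToContinuum.Crystallization.Theorems.IsometryAtomsMinimisingLawsCohesive.GroupStructure

/-! ## Unit vectors on a line -/

/-- A unit vector which is a multiple of a unit vector `u` is `±u`. -/
theorem eq_or_eq_neg_of_smul_of_norm {u w : EuclideanSpace ℝ (Fin 3)} (hu1 : ‖u‖ = 1) {c : ℝ} (hw : w = c • u)
    (hw1 : ‖w‖ = 1) : w = u ∨ w = -u := by
  have hc : |c| = 1 := by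
    have := hw1
    rw [hw, norm_smul, hu1, mul_one, Real.norm_eq_abs] at this
    exact this
  rcases abs_eq (zero_le_one) |>.1 hc with h | h
  · left; rw [hw, h, one_smul]
  · right; rw [hw, h, neg_one_smul]

/-- If an isometry maps `u` to `±u`, so does its inverse (with the same sign). -/
theorem symm_apply_eq_or {B : EuclideanSpace ℝ (Fin 3) ≃ₗᵢ[ℝ] EuclideanSpace ℝ (Fin 3)} {u : EuclideanSpace ℝ (Fin 3)}
    (h : B u = u ∨ B u = -u) : B.symm u = u ∨ B.symm u = -u := by
  rcases h with h | h
  · left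
    conv_lhs => rw [← h]
    exact B.symm_apply_apply u
  · right
    have h2 : B (-u) = u := by rw [map_neg, h, neg_neg]
    conv_lhs => rw [← h2]
    exact B.symm_apply_apply (-u)

/-- If the inverse of an isometry maps `u` to `±u`, so does the isometry. -/
theorem apply_eq_or_of_symm {B : EuclideanSpace ℝ (Fin 3) ≃ₗᵢ[ℝ] EuclideanSpace ℝ (Fin 3)} {u : EuclideanSpace ℝ (Fin 3)}
    (h : B.symm u = u ∨ B.symm u = -u) : B u = u ∨ B u = -u := by
  have := symm_apply_eq_or (B := B.symm) h
  simpa using this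

/-! ## Fixed vectors of a small nontrivial rotation and of its square -/

section Axis

variable {A : EuclideanSpace ℝ (Fin 3) ≃ₗᵢ[ℝ] EuclideanSpace ℝ (Fin 3)} {u : EuclideanSpace ℝ (Fin 3)}

/-- A unit vector fixed by a nontrivial rotation `A` with axis `u` is `±u`. -/
theorem fixed_unit_eq_or (hdet : LinearMap.det (A.toLinearEquiv : EuclideanSpace ℝ (Fin 3) →ₗ[ℝ] EuclideanSpace ℝ (Fin 3)) = 1)
    (hA1 : A ≠ 1) (hu1 : ‖u‖ = 1) (hu : A u = u) {w : EuclideanSpace ℝ (Fin 3)} (hw1 : ‖w‖ = 1) (hw : A w = w) :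
    w = u ∨ w = -u := by
  have hu0 : u ≠ 0 := by
    intro h; rw [h, norm_zero] at hu1; exact zero_ne_one hu1
  obtain ⟨c, hc⟩ := fixed_mem_span_of_ne_one hdet hA1 hu0 hu hw
  exact eq_or_eq_neg_of_smul_of_norm hu1 hc hw1

/-- The square of a small nontrivial isometry is nontrivial. -/
theorem mul_self_ne_one_of_small (hA1 : A ≠ 1)
    (hsmall : ‖(A.toContinuousLinearEquiv : EuclideanSpace ℝ (Fin 3) →L[ℝ] EuclideanSpace ℝ (Fin 3)) - 1‖ ≤ 1 / 10) :
    A * A ≠ 1 := by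
  intro h2
  apply hA1
  refine eq_one_of_small_of_mul_self (δ := 1 / 10) (by norm_num) (fun x => ?_) h2
  exact (norm_sub_le_dev A x).trans (mul_le_mul_of_nonneg_right hsmall (norm_nonneg x))

/-- A unit vector fixed by `A²` (for a small nontrivial rotation `A` with axis `u`) is `±u`. -/
theorem fixed_sq_unit_eq_or (hA1 : A ≠ 1)
    (hsmall : ‖(A.toContinuousLinearEquiv : EuclideanSpace ℝ (Fin 3) →L[ℝ] EuclideanSpace ℝ (Fin 3)) - 1‖ ≤ 1 / 10)
    (hu1 : ‖u‖ = 1) (hu : A u = u) {w : EuclideanSpace ℝ (Fin 3)} (hw1 : ‖w‖ = 1) (hw : A (A w) = w) :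
    w = u ∨ w = -u := by
  have hdet2 : LinearMap.det ((A * A).toLinearEquiv : EuclideanSpace ℝ (Fin 3) →ₗ[ℝ] EuclideanSpace ℝ (Fin 3)) = 1 :=
    det_mul_self A
  have hA2 : A * A ≠ 1 := mul_self_ne_one_of_small hA1 hsmall
  have hu2 : (A * A) u = u := by
    change A (A u) = u; rw [hu, hu]
  exact fixed_unit_eq_or hdet2 hA2 hu1 hu2 hw1 hw

/-- **Base case**: an isometry commuting with `A` maps the axis to `±` itself. -/
theorem axis_of_commute (hdet : LinearMap.det (A.toLinearEquiv : EuclideanSpace ℝ (Fin 3) →ₗ[ℝ] EuclideanSpace ℝ (Fin 3)) = 1)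
    (hA1 : A ≠ 1) (hu1 : ‖u‖ = 1) (hu : A u = u) {B : EuclideanSpace ℝ (Fin 3) ≃ₗᵢ[ℝ] EuclideanSpace ℝ (Fin 3)}
    (hcomm : A * B = B * A) : B u = u ∨ B u = -u := by
  have hfix : A (B u) = B u := by
    have := congrArg (fun M : EuclideanSpace ℝ (Fin 3) ≃ₗᵢ[ℝ] EuclideanSpace ℝ (Fin 3) => M u) hcomm
    simp only [LinearIsometryEquiv.coe_mul, Function.comp_apply] at this
    rw [this, hu]
  exact fixed_unit_eq_or hdet hA1 hu1 hu (by rw [B.norm_map, hu1]) hfix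

/-- **Induction step**: if the commutator `A B A⁻¹ B⁻¹` maps `u` to `±u` then so does `B`
(`w = B⁻¹ u` is fixed by `A²`). -/
theorem axis_of_commutator (hA1 : A ≠ 1)
    (hsmall : ‖(A.toContinuousLinearEquiv : EuclideanSpace ℝ (Fin 3) →L[ℝ] EuclideanSpace ℝ (Fin 3)) - 1‖ ≤ 1 / 10)
    (hu1 : ‖u‖ = 1) (hu : A u = u) {B : EuclideanSpace ℝ (Fin 3) ≃ₗᵢ[ℝ] EuclideanSpace ℝ (Fin 3)}
    (h : (A * B * A⁻¹ * B⁻¹) u = u ∨ (A * B * A⁻¹ * B⁻¹) u = -u) : B u = u ∨ B u = -u := by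
  -- `C = B A⁻¹ B⁻¹` satisfies `C u = ±u`, hence `C (C u) = u`
  have hAinv : A.symm u = u := by
    conv_lhs => rw [← hu]
    exact A.symm_apply_apply u
  have hC : B (A.symm (B.symm u)) = u ∨ B (A.symm (B.symm u)) = -u := by
    -- apply `A⁻¹` to `h`
    rcases h with h | h
    · left
      have := congrArg A.symm h
      simp only [LinearIsometryEquiv.coe_mul, Function.comp_apply, LinearIsometryEquiv.coe_inv,
        LinearIsometryEquiv.symm_apply_apply] at this
      rw [this, hAinv]
    · right
      have := congrArg A.symm h
      simp only [LinearIsometryEquiv.coe_mul, Function.comp_apply, LinearIsometryEquiv.coe_inv,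
        LinearIsometryEquiv.symm_apply_apply, map_neg] at this
      rw [this, hAinv]
  have hCC : B (A.symm (B.symm (B (A.symm (B.symm u))))) = u := by
    rcases hC with hC | hC
    · rw [hC, hC]
    · rw [hC, map_neg, map_neg, map_neg, hC, neg_neg]
  rw [B.symm_apply_apply] at hCC
  -- so `w = B⁻¹ u` is fixed by `A⁻²`, hence by `A²`
  set w := B.symm u with hw
  have hw2 : A.symm (A.symm w) = w := by
    have := congrArg B.symm hCC
    rwa [B.symm_apply_apply] at this
  have hw2' : A (A w) = w := by
    have := congrArg (fun x => A (A x)) hw2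
    simp only [LinearIsometryEquiv.apply_symm_apply] at this
    exact this.symm
  have hw1 : ‖w‖ = 1 := by rw [hw, B.symm.norm_map, hu1]
  have hwu : w = u ∨ w = -u := fixed_sq_unit_eq_or hA1 hsmall hu1 hu hw1 hw2'
  exact apply_eq_or_of_symm hwu

end Axis

/-! ## All linear parts preserve the axis (no translations) -/

/-- **Bieberbach's lemma, rank zero.** `Γ` discontinuous without nontrivial translations;
`g ∈ Γ` with linear part `A ≠ 1`, `det A = 1`, `‖A - 1‖ ≤ 1/10`, axis `u`. Then every
`h ∈ Γ` has `L(h) u = u ∨ L(h) u = -u`. -/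
theorem lin_axis_of_no_translations {Γ : Subgroup (EuclideanSpace ℝ (Fin 3) ≃ᵢ EuclideanSpace ℝ (Fin 3))}
    (hΓ : IsDiscontinuous Γ) (hT : ∀ v ∈ translationVectors Γ, v = 0)
    {g : EuclideanSpace ℝ (Fin 3) ≃ᵢ EuclideanSpace ℝ (Fin 3)} (hg : g ∈ Γ)
    (hA1 : g.toRealLinearIsometryEquiv ≠ 1)
    (hdet : LinearMap.det (g.toRealLinearIsometryEquiv.toLinearEquiv : EuclideanSpace ℝ (Fin 3) →ₗ[ℝ] EuclideanSpace ℝ (Fin 3)) = 1)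
    (hsmall : ‖(g.toRealLinearIsometryEquiv.toContinuousLinearEquiv :
      EuclideanSpace ℝ (Fin 3) →L[ℝ] EuclideanSpace ℝ (Fin 3)) - 1‖ ≤ 1 / 10)
    {u : EuclideanSpace ℝ (Fin 3)} (hu1 : ‖u‖ = 1) (hu : g.toRealLinearIsometryEquiv u = u)
    {h : EuclideanSpace ℝ (Fin 3) ≃ᵢ EuclideanSpace ℝ (Fin 3)} (hh : h ∈ Γ) :
    h.toRealLinearIsometryEquiv u = u ∨ h.toRealLinearIsometryEquiv u = -u := by
  -- the commutator sequence
  let k : ℕ → (EuclideanSpace ℝ (Fin 3) ≃ᵢ EuclideanSpace ℝ (Fin 3)) :=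
    fun j => Nat.rec h (fun _ kj => g * kj * g⁻¹ * kj⁻¹) j
  have hk0 : k 0 = h := rfl
  have hks : ∀ j, k (j + 1) = g * k j * g⁻¹ * (k j)⁻¹ := fun j => rfl
  have hfixT : ∀ v ∈ translationVectors Γ, g.toRealLinearIsometryEquiv v = v := by
    intro v hv; rw [hT v hv, map_zero]
  obtain ⟨J, hJ⟩ := exists_commSeq_eq_one hΓ hg hh hsmall hfixT hk0 hks
  have hQ := commSeq_downward (k := k) (g := g)
    (Q := fun f => f.toRealLinearIsometryEquiv u = u ∨ f.toRealLinearIsometryEquiv u = -u) hks hJ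
    (fun f hf => by
      apply axis_of_commute hdet hA1 hu1 hu
      rw [← lin_mul, ← lin_mul, hf])
    (fun j hj => by
      apply axis_of_commutator hA1 hsmall hu1 hu
      have : (k (j + 1)).toRealLinearIsometryEquiv =
          g.toRealLinearIsometryEquiv * (k j).toRealLinearIsometryEquiv * g.toRealLinearIsometryEquiv⁻¹ *
            ((k j).toRealLinearIsometryEquiv)⁻¹ := by
        rw [hks, lin_mul, lin_mul, lin_mul, lin_inv, lin_inv]
      rw [← this]
      exact hj)
  simpa [hk0] using hQ

/-- Anchor (registered sub-goal of `stub_groupStructure`): **Bieberbach's lemma in rank zero** —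
all linear parts preserve the axis of a small rotation when there are no translations. -/
theorem groupStructure_lin_axis_of_no_translations : ∀ Γ : Subgroup (EuclideanSpace ℝ (Fin 3) ≃ᵢ EuclideanSpace ℝ (Fin 3)), Literature.Geometry.DiscreteGeometry.Crystallographic.IsDiscontinuous Γ → (∀ v ∈ Literature.Geometry.DiscreteGeometry.Crystallographic.translationVectors Γ, v = 0) → ∀ g ∈ Γ, g.toRealLinearIsometryEquiv ≠ 1 → LinearMap.det (g.toRealLinearIsometryEquiv.toLinearEquiv : EuclideanSpace ℝ (Fin 3) →ₗ[ℝ] EuclideanSpace ℝ (Fin 3)) = 1 → ‖(g.toRealLinearIsometryEquiv.toContinuousLinearEquiv : EuclideanSpace ℝ (Fin 3) →L[ℝ] EuclideanSpace ℝ (Fin 3)) - 1‖ ≤ 1 / 10 → ∀ u : EuclideanSpace ℝ (Fin 3), ‖u‖ = 1 → g.toRealLinearIsometryEquiv u = u → ∀ h ∈ Γ, h.toRealLinearIsometryEquiv u = u ∨ h.toRealLinearIsometryEquiv u = -u := by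
  intro Γ hΓ hT g hg hA1 hdet hsmall u hu1 hu h hh
  exact lin_axis_of_no_translations hΓ hT hg hA1 hdet hsmall hu1 hu hh

end Summit.AtomisticToContinuum.Crystallization.Theorems.IsometryAtomsMinimisingLawsCohesive.GroupStructure

end
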